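import Mathlib
import Summits.AnomalousDissipation.AnomalousDissipation.Theorems.DyadicWallCascadeHalfSpaceHierarchyXIndepStreamFunction
import Summits.AnomalousDissipation.AnomalousDissipation.Theorems.DyadicWallCascadeHalfSpaceHierarchySlabExtension

/-!
# Slice tools for the 2½-D no-go (line `Sketch`, crux `DyadicWallCascade.HalfSpaceHierarchy`)

Tool lemmas (item stmt-AnomalousDissipation-18627, continuation lead c1) for the negative lemma
`not_xIndependentHalfSpaceHierarchy` ("no witness of the crux is independent of `x`"):

* `xIndep_periodic_of_le_two` — dilation invariance on the half-space plus a horizontal period on the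
  band `1 ≤ z ≤ 2` give the same period at every height `0 < z ≤ 2` (cumulative dyadic induction);
* the slice map `(y, z) ↦ (0, y, z)` and its calculus (`xIndep_hasFDerivAt_slice`,
  `xIndep_hasFDerivAt_slice_comp`, `xIndep_fderiv_slice_comp_apply`, `xIndep_contDiffOn_slice_comp`,
  `xIndep_contDiff_line_comp`, `xIndep_hasDerivAt_line_comp`);
* `xIndep_fderiv_single_zero_of_invariant` (`∂ₓ g = 0` for an `x`-invariant `g`) and
  `xIndep_bernoulli_transport` (`D(‖V‖²/2 + Q)(X)(V X) = 0` for steady Euler);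
* `xIndep_exists_normalised_streamFunction` — the stream function of `stub_xIndepStreamFunction`
  normalised so that `ψ (2X) = 2 ψ X` (dilation law), `xIndep_streamFunction_period` (a horizontal
  period of `V` is a period of `ψ` up to an additive constant on `0 < z < 2`), `xIndep_dilate_pow_fun`;
* `xIndep_periodic_bound` — a continuous `1`-periodic real function is bounded.

The file ends with the registered tools stub `stub_xIndepSliceTools` (conjunction of the three
headline tools).  Everything is folklore calculus; no definitions, no named facts.
-/

set_option linter.dupNamespace false

open scoped Topology InnerProductSpace
open MeasureTheory Filter Set

noncomputable section

namespace Summit.AnomalousDissipation.AnomalousDissipation.Theorems.HalfSpaceHierarchy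

/-! ## §1 Periods propagate down to the wall -/

/-- **Dyadic descent of a horizontal period.** If `f (2X) = f X` on the open half-space and
`f (X + v) = f X` on the closed band `1 ≤ z ≤ 2` for a horizontal vector `v` (`v₂ = 0`), then
`f (X + v) = f X` at every height `0 < z ≤ 2`: on `2^{-k-1} ≤ z < 2^{-k}` write
`f (X + v) = f (2X + 2v) = f (2X + v) = f (2X) = f X`. [folklore] -/
theorem xIndep_periodic_of_le_two {α : Type*} (f : EuclideanSpace ℝ (Fin 3) → α)
    {v : EuclideanSpace ℝ (Fin 3)} (hv : v 2 = 0)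
    (hdil : ∀ X : EuclideanSpace ℝ (Fin 3), 0 < X 2 → f ((2 : ℝ) • X) = f X)
    (hper : ∀ X : EuclideanSpace ℝ (Fin 3), 1 ≤ X 2 → X 2 ≤ 2 → f (X + v) = f X) :
    ∀ X : EuclideanSpace ℝ (Fin 3), 0 < X 2 → X 2 ≤ 2 → f (X + v) = f X := by
  have key : ∀ k : ℕ, ∀ X : EuclideanSpace ℝ (Fin 3),
      ((2 : ℝ) ^ k)⁻¹ ≤ X 2 → X 2 ≤ 2 → f (X + v) = f X := by
    intro k
    induction k with
    | zero => intro X h1 h2; exact hper X (by simpa using h1) h2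
    | succ k ih =>
      intro X h1 h2
      rcases le_or_gt ((2 : ℝ) ^ k)⁻¹ (X 2) with hk | hk
      · exact ih X hk h2
      · have hpos : (0 : ℝ) < ((2 : ℝ) ^ (k + 1))⁻¹ := by positivity
        have hX2 : 0 < X 2 := lt_of_lt_of_le hpos h1
        have hXv : 0 < (X + v) 2 := by simp [hv, hX2]
        have hk1 : ((2 : ℝ) ^ k)⁻¹ ≤ 1 := inv_le_one_of_one_le₀ (one_le_pow₀ (by norm_num))
        have e : ((2 : ℝ) ^ k)⁻¹ = 2 * ((2 : ℝ) ^ (k + 1))⁻¹ := by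
          rw [pow_succ]; field_simp
        have h2X1 : ((2 : ℝ) ^ k)⁻¹ ≤ ((2 : ℝ) • X) 2 := by
          simp only [PiLp.smul_apply, smul_eq_mul]
          rw [e]; exact mul_le_mul_of_nonneg_left h1 (by norm_num)
        have h2X2 : ((2 : ℝ) • X) 2 ≤ 2 := by
          simp only [PiLp.smul_apply, smul_eq_mul]; linarith
        have h2Xv1 : ((2 : ℝ) ^ k)⁻¹ ≤ ((2 : ℝ) • X + v) 2 := by
          simpa [hv] using h2X1
        have h2Xv2 : ((2 : ℝ) • X + v) 2 ≤ 2 := by simpa [hv] using h2X2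
        calc f (X + v) = f ((2 : ℝ) • (X + v)) := (hdil _ hXv).symm
          _ = f (((2 : ℝ) • X + v) + v) := by rw [smul_add, two_smul ℝ v, add_assoc]
          _ = f ((2 : ℝ) • X + v) := ih _ h2Xv1 h2Xv2
          _ = f ((2 : ℝ) • X) := ih _ h2X1 h2X2
          _ = f X := hdil X hX2
  intro X hX hX2
  obtain ⟨k, hk⟩ := pow_unbounded_of_one_lt (X 2)⁻¹ (one_lt_two : (1 : ℝ) < 2)
  exact key k X (le_of_lt (inv_lt_of_inv_lt₀ hX hk)) hX2

/-! ## §2 The slice map `(y, z) ↦ (0, y, z)` -/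

/-- The slice map `(y, z) ↦ (0, y, z) ∈ ℝ³` is the linear map `(y, z) ↦ y e₁ + z e₂`. [folklore] -/
theorem xIndep_slice_eq (q : ℝ × ℝ) :
    (!₂[(0 : ℝ), q.1, q.2] : EuclideanSpace ℝ (Fin 3)) =
      q.1 • EuclideanSpace.single (1 : Fin 3) (1 : ℝ) + q.2 • EuclideanSpace.single (2 : Fin 3) (1 : ℝ) := by
  ext i; fin_cases i <;> simp

/-- Derivative of the slice map: `(a, b) ↦ a e₁ + b e₂`. [folklore] -/
theorem xIndep_hasFDerivAt_slice (p : ℝ × ℝ) :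
    HasFDerivAt (fun q : ℝ × ℝ => (!₂[(0 : ℝ), q.1, q.2] : EuclideanSpace ℝ (Fin 3)))
      ((ContinuousLinearMap.fst ℝ ℝ ℝ).smulRight (EuclideanSpace.single (1 : Fin 3) (1 : ℝ)) +
        (ContinuousLinearMap.snd ℝ ℝ ℝ).smulRight (EuclideanSpace.single (2 : Fin 3) (1 : ℝ))) p := by
  have h : (fun q : ℝ × ℝ => (!₂[(0 : ℝ), q.1, q.2] : EuclideanSpace ℝ (Fin 3))) =
      fun q : ℝ × ℝ => q.1 • EuclideanSpace.single (1 : Fin 3) (1 : ℝ) +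
        q.2 • EuclideanSpace.single (2 : Fin 3) (1 : ℝ) := funext xIndep_slice_eq
  rw [h]
  exact ((hasFDerivAt_fst (p := p)).smul_const _).add ((hasFDerivAt_snd (p := p)).smul_const _)

/-- The slice map is smooth. [folklore] -/
theorem xIndep_contDiff_slice {n : WithTop ℕ∞} :
    ContDiff ℝ n (fun q : ℝ × ℝ => (!₂[(0 : ℝ), q.1, q.2] : EuclideanSpace ℝ (Fin 3))) := by
  have h : (fun q : ℝ × ℝ => (!₂[(0 : ℝ), q.1, q.2] : EuclideanSpace ℝ (Fin 3))) =
      fun q : ℝ × ℝ => q.1 • EuclideanSpace.single (1 : Fin 3) (1 : ℝ) +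
        q.2 • EuclideanSpace.single (2 : Fin 3) (1 : ℝ) := funext xIndep_slice_eq
  rw [h]
  fun_prop

/-- **Chain rule through the slice map.** If `g` has derivative `L` at `(0, y, z)` then
`q ↦ g (0, q.1, q.2)` has derivative `L ∘ slice` at `(y, z)`, whose values on `(1, 0)` and `(0, 1)`
are `L e₁` and `L e₂`. [folklore] -/
theorem xIndep_hasFDerivAt_slice_comp {F : Type*} [NormedAddCommGroup F] [NormedSpace ℝ F]
    (g : EuclideanSpace ℝ (Fin 3) → F) {p : ℝ × ℝ} {L : EuclideanSpace ℝ (Fin 3) →L[ℝ] F}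
    (hg : HasFDerivAt g L (!₂[(0 : ℝ), p.1, p.2])) :
    HasFDerivAt (fun q : ℝ × ℝ => g !₂[(0 : ℝ), q.1, q.2])
      (L.comp ((ContinuousLinearMap.fst ℝ ℝ ℝ).smulRight (EuclideanSpace.single (1 : Fin 3) (1 : ℝ)) +
        (ContinuousLinearMap.snd ℝ ℝ ℝ).smulRight (EuclideanSpace.single (2 : Fin 3) (1 : ℝ)))) p :=
  hg.comp p (xIndep_hasFDerivAt_slice p)

/-- Partial derivatives of `q ↦ g (0, q.1, q.2)`: `∂_y = Dg e₁`, `∂_z = Dg e₂`. [folklore] -/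
theorem xIndep_fderiv_slice_comp_apply {F : Type*} [NormedAddCommGroup F] [NormedSpace ℝ F]
    (g : EuclideanSpace ℝ (Fin 3) → F) {p : ℝ × ℝ} {L : EuclideanSpace ℝ (Fin 3) →L[ℝ] F}
    (hg : HasFDerivAt g L (!₂[(0 : ℝ), p.1, p.2])) :
    fderiv ℝ (fun q : ℝ × ℝ => g !₂[(0 : ℝ), q.1, q.2]) p (1, 0) = L (EuclideanSpace.single (1 : Fin 3) (1 : ℝ)) ∧
    fderiv ℝ (fun q : ℝ × ℝ => g !₂[(0 : ℝ), q.1, q.2]) p (0, 1) = L (EuclideanSpace.single (2 : Fin 3) (1 : ℝ)) := by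
  rw [(xIndep_hasFDerivAt_slice_comp g hg).fderiv]
  constructor <;> simp

/-- A function `C^n` on the open half-space is `C^n` along the slice, on the open half-plane. [folklore] -/
theorem xIndep_contDiffOn_slice_comp {F : Type*} [NormedAddCommGroup F] [NormedSpace ℝ F]
    (g : EuclideanSpace ℝ (Fin 3) → F) {n : WithTop ℕ∞}
    (hg : ContDiffOn ℝ n g {X : EuclideanSpace ℝ (Fin 3) | 0 < X 2}) :
    ContDiffOn ℝ n (fun q : ℝ × ℝ => g !₂[(0 : ℝ), q.1, q.2]) {p : ℝ × ℝ | 0 < p.2} :=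
  hg.comp xIndep_contDiff_slice.contDiffOn fun q hq => by simpa using hq

/-- A function `C^n` on the open half-space is `C^n` along the horizontal line `s ↦ (0, s, c)`, `c > 0`.
[folklore] -/
theorem xIndep_contDiff_line_comp {F : Type*} [NormedAddCommGroup F] [NormedSpace ℝ F]
    (g : EuclideanSpace ℝ (Fin 3) → F) {n : WithTop ℕ∞} {c : ℝ} (hc : 0 < c)
    (hg : ContDiffOn ℝ n g {X : EuclideanSpace ℝ (Fin 3) | 0 < X 2}) :
    ContDiff ℝ n (fun s : ℝ => g !₂[(0 : ℝ), s, c]) := by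
  have h1 : ContDiff ℝ n (fun s : ℝ => ((s, c) : ℝ × ℝ)) := by fun_prop
  have h2 := xIndep_contDiff_slice.comp h1
  exact hg.comp_contDiff h2 fun s => by simpa using hc

/-- Derivative along the horizontal line `s ↦ (0, s, c)`: `(g ∘ line)' = Dg e₁`. [folklore] -/
theorem xIndep_hasDerivAt_line_comp {F : Type*} [NormedAddCommGroup F] [NormedSpace ℝ F]
    (g : EuclideanSpace ℝ (Fin 3) → F) {s c : ℝ} {L : EuclideanSpace ℝ (Fin 3) →L[ℝ] F}
    (hg : HasFDerivAt g L (!₂[(0 : ℝ), s, c])) :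
    HasDerivAt (fun r : ℝ => g !₂[(0 : ℝ), r, c]) (L (EuclideanSpace.single (1 : Fin 3) (1 : ℝ))) s := by
  have hl : HasDerivAt (fun r : ℝ => (!₂[(0 : ℝ), r, c] : EuclideanSpace ℝ (Fin 3)))
      (EuclideanSpace.single (1 : Fin 3) (1 : ℝ)) s := by
    have h : (fun r : ℝ => (!₂[(0 : ℝ), r, c] : EuclideanSpace ℝ (Fin 3))) =
        fun r : ℝ => r • EuclideanSpace.single (1 : Fin 3) (1 : ℝ) +
          c • EuclideanSpace.single (2 : Fin 3) (1 : ℝ) := by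
      funext r; simpa using xIndep_slice_eq (r, c)
    rw [h]
    simpa using ((hasDerivAt_id s).smul_const (EuclideanSpace.single (1 : Fin 3) (1 : ℝ))).add_const
      (c • EuclideanSpace.single (2 : Fin 3) (1 : ℝ))
  exact hg.comp_hasDerivAt s hl

/-! ## §3 Pointwise identities: `x`-invariance and the Bernoulli transport -/

/-- **`∂ₓ g = 0` for an `x`-invariant function** (any target): if `g` is differentiable at `X` and
`g (X + t e₀) = g X` for all `t`, then `Dg(X) e₀ = 0`. [folklore] -/
theorem xIndep_fderiv_single_zero_of_invariant {F : Type*} [NormedAddCommGroup F] [NormedSpace ℝ F]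
    (g : EuclideanSpace ℝ (Fin 3) → F) {X : EuclideanSpace ℝ (Fin 3)} (hd : DifferentiableAt ℝ g X)
    (hx : ∀ t : ℝ, g (X + t • EuclideanSpace.single 0 (1 : ℝ)) = g X) :
    fderiv ℝ g X (EuclideanSpace.single 0 (1 : ℝ)) = 0 := by
  set e₀ : EuclideanSpace ℝ (Fin 3) := EuclideanSpace.single 0 (1 : ℝ) with he₀
  have hc : HasDerivAt (fun t : ℝ => X + t • e₀) e₀ 0 := by
    simpa using ((hasDerivAt_id (0 : ℝ)).smul_const e₀).const_add X
  have hcomp : HasDerivAt (g ∘ fun t : ℝ => X + t • e₀) (fderiv ℝ g X e₀) 0 :=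
    hd.hasFDerivAt.comp_hasDerivAt_of_eq (0 : ℝ) hc (by simp)
  have hconst : (g ∘ fun t : ℝ => X + t • e₀) = fun _ => g X := funext fun t => hx t
  rw [hconst] at hcomp
  exact hcomp.unique (hasDerivAt_const 0 (g X))

/-- **Bernoulli transport.** For `V, Q` differentiable at `X` with `DV(X)(V X) + ∇Q(X) = 0`, the head
`B = ‖V‖²/2 + Q` satisfies `DB(X)(V X) = ⟪V, DV V + ∇Q⟫ = 0`. [folklore] -/
theorem xIndep_bernoulli_transport {V : EuclideanSpace ℝ (Fin 3) → EuclideanSpace ℝ (Fin 3)}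
    {Q : EuclideanSpace ℝ (Fin 3) → ℝ} {X : EuclideanSpace ℝ (Fin 3)}
    (hV : DifferentiableAt ℝ V X) (hQ : DifferentiableAt ℝ Q X)
    (hEul : (fderiv ℝ V X) (V X) + gradient Q X = 0) :
    HasFDerivAt (fun Y => ‖V Y‖ ^ 2 / 2 + Q Y)
      ((1 / 2 : ℝ) • (2 • (innerSL ℝ (V X)).comp (fderiv ℝ V X)) + fderiv ℝ Q X) X ∧
    ((1 / 2 : ℝ) • (2 • (innerSL ℝ (V X)).comp (fderiv ℝ V X)) + fderiv ℝ Q X) (V X) = 0 := by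
  have hA : HasFDerivAt (fun Y => ‖V Y‖ ^ 2 / 2)
      ((1 / 2 : ℝ) • (2 • (innerSL ℝ (V X)).comp (fderiv ℝ V X))) X := by
    have h := (hV.hasFDerivAt.norm_sq).const_mul (1 / 2 : ℝ)
    refine h.congr_of_eventuallyEq ?_
    exact Filter.Eventually.of_forall fun y => by simp [div_eq_inv_mul]
  refine ⟨hA.add hQ.hasFDerivAt, ?_⟩
  have hgrad : fderiv ℝ Q X (V X) = ⟪gradient Q X, V X⟫_ℝ := by
    rw [gradient, InnerProductSpace.toDual_symm_apply]
  have hQ' : gradient Q X = -((fderiv ℝ V X) (V X)) := eq_neg_of_add_eq_zero_right hEul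
  have e1 : ((1 / 2 : ℝ) • (2 • (innerSL ℝ (V X)).comp (fderiv ℝ V X)) + fderiv ℝ Q X) (V X)
      = ⟪V X, fderiv ℝ V X (V X)⟫_ℝ + fderiv ℝ Q X (V X) := by simp
  rw [e1, hgrad, hQ', inner_neg_left, real_inner_comm]
  simp

/-! ## §4 The normalised stream function -/

/-- Iterating a degree-one dilation law: `ψ (2^k X) = 2^k ψ X`. [folklore] -/
theorem xIndep_dilate_pow_fun (ψ : EuclideanSpace ℝ (Fin 3) → ℝ)
    (h : ∀ X : EuclideanSpace ℝ (Fin 3), 0 < X 2 → ψ ((2 : ℝ) • X) = 2 * ψ X) :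
    ∀ (k : ℕ) (X : EuclideanSpace ℝ (Fin 3)), 0 < X 2 → ψ ((2 : ℝ) ^ k • X) = 2 ^ k * ψ X := by
  intro k
  induction k with
  | zero => intro X _; simp
  | succ k ih =>
    intro X hX
    have hkX : 0 < ((2 : ℝ) ^ k • X) 2 := by
      simp only [PiLp.smul_apply, smul_eq_mul]; positivity
    rw [pow_succ, mul_comm, mul_smul, h _ hkX, ih X hX]; ring

/-- **Normalised stream function.** For an `x`-independent, divergence-free, dilation-invariant
smooth field `V` on the half-space there is a smooth `ψ` with `dψ = V₁ dz − V₂ dy` AND the degree-one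
dilation law `ψ (2X) = 2 ψ X`: the stream function of `stub_xIndepStreamFunction` satisfies
`ψ₀ (2X) = 2 ψ₀ X + a` (both sides have derivative `2 dψ₀(X)` on the connected open half-space), and
`ψ := ψ₀ + a` works. [folklore] -/
theorem xIndep_exists_normalised_streamFunction
    (V : EuclideanSpace ℝ (Fin 3) → EuclideanSpace ℝ (Fin 3))
    (hV : ContDiffOn ℝ ((⊤ : ℕ∞) : WithTop ℕ∞) V {X : EuclideanSpace ℝ (Fin 3) | 0 < X 2})
    (hx : ∀ X : EuclideanSpace ℝ (Fin 3), 0 < X 2 → ∀ t : ℝ, V (X + t • EuclideanSpace.single 0 (1 : ℝ)) = V X)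
    (hdiv : ∀ X : EuclideanSpace ℝ (Fin 3), 0 < X 2 →
      ∑ i : Fin 3, (fderiv ℝ V X (EuclideanSpace.single i (1 : ℝ))) i = 0)
    (hdil : ∀ X : EuclideanSpace ℝ (Fin 3), 0 < X 2 → V ((2 : ℝ) • X) = V X) :
    ∃ ψ : EuclideanSpace ℝ (Fin 3) → ℝ,
      ContDiffOn ℝ ((⊤ : ℕ∞) : WithTop ℕ∞) ψ {X : EuclideanSpace ℝ (Fin 3) | 0 < X 2} ∧
      (∀ X : EuclideanSpace ℝ (Fin 3), 0 < X 2 →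
        HasFDerivAt ψ ((V X 1) • (EuclideanSpace.proj (2 : Fin 3) : EuclideanSpace ℝ (Fin 3) →L[ℝ] ℝ)
          - (V X 2) • (EuclideanSpace.proj (1 : Fin 3) : EuclideanSpace ℝ (Fin 3) →L[ℝ] ℝ)) X) ∧
      (∀ X : EuclideanSpace ℝ (Fin 3), 0 < X 2 → ψ ((2 : ℝ) • X) = 2 * ψ X) := by
  obtain ⟨ψ₀, hψ₀s, hψ₀d⟩ := stub_xIndepStreamFunction V hV hx hdiv
  set H : Set (EuclideanSpace ℝ (Fin 3)) := {X | 0 < X 2} with hH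
  have hHo : IsOpen H := isOpen_halfSpace_coord_two_pos
  have hHc : IsPreconnected H := HalfSpaceHierarchyNegative.convex_halfSpace.isPreconnected
  -- derivative of `X ↦ ψ₀ (2X)` and of `X ↦ 2 ψ₀ X`
  have hf : ∀ X ∈ H, HasFDerivAt (fun Y => ψ₀ ((2 : ℝ) • Y))
      ((2 : ℝ) • ((V X 1) • (EuclideanSpace.proj (2 : Fin 3) : EuclideanSpace ℝ (Fin 3) →L[ℝ] ℝ)
        - (V X 2) • (EuclideanSpace.proj (1 : Fin 3) : EuclideanSpace ℝ (Fin 3) →L[ℝ] ℝ))) X := by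
    intro X hX
    have h2X : 0 < ((2 : ℝ) • X) 2 := by
      have : (0 : ℝ) < X 2 := hX
      simp only [PiLp.smul_apply, smul_eq_mul]; linarith
    have hc := (hψ₀d ((2 : ℝ) • X) h2X).comp X ((hasFDerivAt_id X).const_smul (2 : ℝ))
    rw [hdil X hX] at hc
    refine hc.congr_fderiv ?_
    ext h
    simp [mul_comm]
  have hg : ∀ X ∈ H, HasFDerivAt (fun Y => 2 * ψ₀ Y)
      ((2 : ℝ) • ((V X 1) • (EuclideanSpace.proj (2 : Fin 3) : EuclideanSpace ℝ (Fin 3) →L[ℝ] ℝ)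
        - (V X 2) • (EuclideanSpace.proj (1 : Fin 3) : EuclideanSpace ℝ (Fin 3) →L[ℝ] ℝ))) X := by
    intro X hX
    exact (hψ₀d X hX).const_mul (2 : ℝ)
  obtain ⟨a, ha⟩ := hHo.exists_eq_add_of_fderiv_eq hHc
    (fun X hX => (hf X hX).differentiableAt.differentiableWithinAt)
    (fun X hX => (hg X hX).differentiableAt.differentiableWithinAt)
    (fun X hX => by rw [(hf X hX).fderiv, (hg X hX).fderiv])
  refine ⟨fun X => ψ₀ X + a, hψ₀s.add contDiffOn_const, fun X hX => ?_, fun X hX => ?_⟩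
  · simpa using (hψ₀d X hX).add_const a
  · have := ha (show X ∈ H from hX)
    simp only at this
    show ψ₀ ((2 : ℝ) • X) + a = 2 * (ψ₀ X + a)
    rw [this]; ring

/-- **A horizontal period of `V` is a period of the stream function up to a constant** on the open
band `0 < z < 2`: `X ↦ ψ (X + v)` and `ψ` have the same derivative there. [folklore] -/
theorem xIndep_streamFunction_period
    (V : EuclideanSpace ℝ (Fin 3) → EuclideanSpace ℝ (Fin 3)) (ψ : EuclideanSpace ℝ (Fin 3) → ℝ)
    (hψ : ∀ X : EuclideanSpace ℝ (Fin 3), 0 < X 2 →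
      HasFDerivAt ψ ((V X 1) • (EuclideanSpace.proj (2 : Fin 3) : EuclideanSpace ℝ (Fin 3) →L[ℝ] ℝ)
        - (V X 2) • (EuclideanSpace.proj (1 : Fin 3) : EuclideanSpace ℝ (Fin 3) →L[ℝ] ℝ)) X)
    {v : EuclideanSpace ℝ (Fin 3)} (hv : v 2 = 0)
    (hper : ∀ X : EuclideanSpace ℝ (Fin 3), 0 < X 2 → X 2 ≤ 2 → V (X + v) = V X) :
    ∃ c : ℝ, ∀ X : EuclideanSpace ℝ (Fin 3), 0 < X 2 → X 2 < 2 → ψ (X + v) = ψ X + c := by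
  set S : Set (EuclideanSpace ℝ (Fin 3)) := {X | 0 < X 2 ∧ X 2 < 2} with hS
  have hSo : IsOpen S := slabExt_isOpen_band 0 2
  have hSc : IsPreconnected S := by
    have h1 : Convex ℝ {X : EuclideanSpace ℝ (Fin 3) | 0 < X 2} := HalfSpaceHierarchyNegative.convex_halfSpace
    have h2 : Convex ℝ {X : EuclideanSpace ℝ (Fin 3) | X 2 < 2} := by
      have hlin : IsLinearMap ℝ fun X : EuclideanSpace ℝ (Fin 3) => X 2 :=
        ⟨fun X Y => by simp, fun c X => by simp⟩
      exact convex_halfSpace_lt hlin 2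
    have : S = {X : EuclideanSpace ℝ (Fin 3) | 0 < X 2} ∩ {X | X 2 < 2} := by
      ext X; simp [hS]
    rw [this]
    exact (h1.inter h2).isPreconnected
  have hf : ∀ X ∈ S, HasFDerivAt (fun Y => ψ (Y + v))
      ((V X 1) • (EuclideanSpace.proj (2 : Fin 3) : EuclideanSpace ℝ (Fin 3) →L[ℝ] ℝ)
        - (V X 2) • (EuclideanSpace.proj (1 : Fin 3) : EuclideanSpace ℝ (Fin 3) →L[ℝ] ℝ)) X := by
    intro X hX
    have hXv : 0 < (X + v) 2 := by simpa [hv] using hX.1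
    have hc := (hψ (X + v) hXv).comp X ((hasFDerivAt_id X).add_const v)
    rw [hper X hX.1 hX.2.le] at hc
    simp only [ContinuousLinearMap.comp_id] at hc
    exact hc
  obtain ⟨c, hc⟩ := hSo.exists_eq_add_of_fderiv_eq hSc
    (fun X hX => (hf X hX).differentiableAt.differentiableWithinAt)
    (fun X hX => (hψ X hX.1).differentiableAt.differentiableWithinAt)
    (fun X hX => by rw [(hf X hX).fderiv, (hψ X hX.1).fderiv])
  exact ⟨c, fun X h1 h2 => hc (show X ∈ S from ⟨h1, h2⟩)⟩

/-! ## §5 Bounded periodic functions -/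

/-- A continuous `1`-periodic real function is bounded. [folklore] -/
theorem xIndep_periodic_bound (g : ℝ → ℝ) (hg : Continuous g) (hper : ∀ s : ℝ, g (s + 1) = g s) :
    ∃ M : ℝ, ∀ s : ℝ, |g s| ≤ M := by
  have hp : Function.Periodic g 1 := hper
  obtain ⟨M, hM⟩ := (isCompact_Icc (a := (0 : ℝ)) (b := 1)).exists_bound_of_continuousOn hg.continuousOn
  refine ⟨M, fun s => ?_⟩
  obtain ⟨y, hy, hgy⟩ := hp.exists_mem_Ico₀ one_pos s
  rw [hgy]
  simpa [Real.norm_eq_abs] using hM y (Ico_subset_Icc_self hy)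

/-! ## §6 Registered tools stub -/

/-- **Tools stub (c1) `stub_xIndepSliceTools`**: conjunction of the three headline tools of this file —
dyadic descent of horizontal periods (`xIndep_periodic_of_le_two`, for vector- and scalar-valued fields),
the normalised stream function (`xIndep_exists_normalised_streamFunction`) and boundedness of continuous
periodic functions (`xIndep_periodic_bound`). [folklore] -/
theorem stub_xIndepSliceTools :
    (∀ (f : EuclideanSpace ℝ (Fin 3) → EuclideanSpace ℝ (Fin 3)) (v : EuclideanSpace ℝ (Fin 3)), v 2 = 0 →
      (∀ X : EuclideanSpace ℝ (Fin 3), 0 < X 2 → f ((2 : ℝ) • X) = f X) →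
      (∀ X : EuclideanSpace ℝ (Fin 3), 1 ≤ X 2 → X 2 ≤ 2 → f (X + v) = f X) →
      ∀ X : EuclideanSpace ℝ (Fin 3), 0 < X 2 → X 2 ≤ 2 → f (X + v) = f X) ∧
    (∀ (f : EuclideanSpace ℝ (Fin 3) → ℝ) (v : EuclideanSpace ℝ (Fin 3)), v 2 = 0 →
      (∀ X : EuclideanSpace ℝ (Fin 3), 0 < X 2 → f ((2 : ℝ) • X) = f X) →
      (∀ X : EuclideanSpace ℝ (Fin 3), 1 ≤ X 2 → X 2 ≤ 2 → f (X + v) = f X) →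
      ∀ X : EuclideanSpace ℝ (Fin 3), 0 < X 2 → X 2 ≤ 2 → f (X + v) = f X) ∧
    (∀ (V : EuclideanSpace ℝ (Fin 3) → EuclideanSpace ℝ (Fin 3)),
      ContDiffOn ℝ ((⊤ : ℕ∞) : WithTop ℕ∞) V {X : EuclideanSpace ℝ (Fin 3) | 0 < X 2} →
      (∀ X : EuclideanSpace ℝ (Fin 3), 0 < X 2 → ∀ t : ℝ, V (X + t • EuclideanSpace.single 0 (1 : ℝ)) = V X) →
      (∀ X : EuclideanSpace ℝ (Fin 3), 0 < X 2 →
        ∑ i : Fin 3, (fderiv ℝ V X (EuclideanSpace.single i (1 : ℝ))) i = 0) →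
      (∀ X : EuclideanSpace ℝ (Fin 3), 0 < X 2 → V ((2 : ℝ) • X) = V X) →
      ∃ ψ : EuclideanSpace ℝ (Fin 3) → ℝ,
        ContDiffOn ℝ ((⊤ : ℕ∞) : WithTop ℕ∞) ψ {X : EuclideanSpace ℝ (Fin 3) | 0 < X 2} ∧
        (∀ X : EuclideanSpace ℝ (Fin 3), 0 < X 2 →
          HasFDerivAt ψ ((V X 1) • (EuclideanSpace.proj (2 : Fin 3) : EuclideanSpace ℝ (Fin 3) →L[ℝ] ℝ)
            - (V X 2) • (EuclideanSpace.proj (1 : Fin 3) : EuclideanSpace ℝ (Fin 3) →L[ℝ] ℝ)) X) ∧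
        (∀ X : EuclideanSpace ℝ (Fin 3), 0 < X 2 → ψ ((2 : ℝ) • X) = 2 * ψ X)) ∧
    (∀ g : ℝ → ℝ, Continuous g → (∀ s : ℝ, g (s + 1) = g s) → ∃ M : ℝ, ∀ s : ℝ, |g s| ≤ M) :=
  ⟨fun f _ hv hdil hper => xIndep_periodic_of_le_two f hv hdil hper,
   fun f _ hv hdil hper => xIndep_periodic_of_le_two f hv hdil hper,
   fun V hV hx hdiv hdil => xIndep_exists_normalised_streamFunction V hV hx hdiv hdil,
   fun g hg hper => xIndep_periodic_bound g hg hper⟩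

end Summit.AnomalousDissipation.AnomalousDissipation.Theorems.HalfSpaceHierarchy

end
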